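import Summits.Ventures.HSemireg.AmplificationChainAssembly
import Summits.Ventures.HSemireg.SiegelComponentChartSheafOn
import HarnessLib

/-!
# Venture HSemireg — the AMPLIFICATION CHAIN in the `𝒜_g` / Hodge-locus-COMPONENT currency, DOOR-AGNOSTICALLY:
# «local variational Hodge statement for an object class `𝒪`» ∧ «ONE `𝒪`-admissible family of classes on ONE model of the
# fibre at ONE point of a Hodge-locus component» ∧ the chart at that component ⟹ algebraic on EVERY member of the component

HONEST FRAMING. Lean index of the computation cell `pub-hsemireg` (seat p7, assembly). NOTHING about any explicit variety is
asserted; every published input and every cell assumption is a hypothesis BY NAME; nothing here says HC, HC_CM or HC_AV is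
proved. No `sorry`, no new axiom, NO definition in this file.

Companion of `AmplificationChainAssembly.lean` (Weil-anchor currency ⟹ `Stubs.WeilAlgebraicSplitHyperplane N d`) for the
coordinator's reading «semiregular representative at a CM point ⟹ HC on THAT Hodge-locus component» (theory seat 3's rows B4–B18,
`theory/TH3-LEAN-CHAIN-SUMMARY.md`): Lean seat p3's one-model vector-bundle door `SiegelComponentChartSheafOn.lean` re-run VERBATIM
with the sheaf data `(ℰ₀, hℰ₀, IsISemiregular hℰ₀ {q | q+1 ∈ I}, Cc.ch X₀ ℰ₀ p)` replaced by an `𝒪`-admissible family of classes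
`(κ, 𝒪 n X₀ I κ, κ p)` and the fact `BuchweitzFlenner2003_variationalHodge_ISemiregular_model` by the hypothesis
`LocalVariationalHodgeFor 𝒪` (which IS that fact for `𝒪 = bfSheafClass Cc`). So every object kind with a BF-5.1-model-SHAPED transfer
statement — lci cycles, vector bundles, the perfect complexes of route (C) once seat p4's `PerfectComplexVariationalHodge C Adm →
LocalVariationalHodgeFor (perfectObjClass C Adm)` is typed — enters th-3's per-component sentence through ONE kernel name.
§1 `LocalVariationalHodgeFor.deforms_model` (GLOBAL form along an irreducible smooth quasi-projective base: Ehresmann, restrictions of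
global classes are the flat transports, Bloch's countable-union step); §2 `.forall_mem_algebraicClasses_of_sweepsClasses{,_of_smul_add}`,
`.hc_on_component{,_of_smul_add}` (CDK chart `SweepsClasses`); §3 `.hc_on_siegelComponent_of_smul_add_at` (chart clause
`SiegelHodgeLocusChartAt D p C`), `…_of_baseChartAt` (base chart ∧ `deligne_globalInvariantCycles`), `…_of_smul_add` (universal chart),
the g = 4 reading `hc_on_siegelFourfoldComponent_of_localVariationalHodgeFor_of_baseChartAt` (`g = 4`, `p = 2`), and the SANITY INSTANCE
`hc_on_siegelComponent_of_sheafSeedOn_of_smul_add_at'` (p3's D2 door in three lines). Inputs BY NAME: `hT : LocalVariationalHodgeFor 𝒪`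
(sheaves: BF Thm. 5.1, refereed; perfect complexes: the cell's typed ASSUMPTION); the chart clauses (cell assumptions, theory seats 2/3;
truth `theory/TH3-CHART-TRUTH.md`); the tree theorem `charlesSchnell_algebraicityLocus_iUnion_closed_holds`; `deligne_globalInvariantCycles`
(cited). NOT inputs: CM-ness of the point, HC_CM, CM density, Mumford–Tate finiteness.
References: [BuchweitzFlenner2003] §5 Thm. 5.1, §6 Ex. 6.2, 7.18 (binder shape); [Bloch1972Semiregularity] proof of (7.4), p. 65;
[CharlesSchnell2014Notes] Prop. 11.3.11; [CattaniDeligneKaplan1995JAMS] Thm. 1.1, Cor. 1.2; [DeligneHodgeII1971] Thm. 4.1.1;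
[MoonenOort2013Torelli] §3; [Markman2025SecantWeil] §1.5 (shape `q·hⁿ + w`; preprint); [FultonYoungTableaux1997] App. B §B.1.
-/

noncomputable section

open CategoryTheory AlgebraicGeometry Set
open Literature.AlgebraicGeometry.Motives Literature.AlgebraicGeometry.HodgeTheory
open Literature.AlgebraicGeometry.ModuliOfAbelianVarieties Literature.AlgebraicGeometry.Deligne1982
open Literature.AlgebraicTopology.SingularHomology

namespace Summit.Ventures.HSemireg

local notation3 (prettyPrint := false) "Res[" f ", " s ", " k ", " A "]" =>
  complexBetti.map (Literature.AlgebraicGeometry.Motives.fiberι f s) k A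

namespace LocalVariationalHodgeFor

variable {𝒪 : ObjClass}

/-! ## 1. The local variational statement for `𝒪`, GLOBAL form, special fibre up to a model isomorphism -/

section Global

variable {n : ℕ}

/-- **The local variational Hodge statement for `𝒪`, made GLOBAL along an irreducible base** (for `𝒪 = bfSheafClass C` this is
`BuchweitzFlenner2003.semiregular_deforms_model`, same proof): smooth projective `f : 𝒳 ⟶ S` of relative dimension `n` (`𝒳`, `S`
quasi-projective, `S` smooth irreducible), `s₀ ∈ S(ℂ)`, model `e : X₀ ≅ 𝒳_{s₀}`, `𝒪`-admissible `κ` on `X₀`, global `W_p` (`p ∈ I`)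
fibrewise `(p,p)` with `e^*(W_p|_{𝒳_{s₀}}) = κ_p` ⟹ `W_p|_{𝒳_t}` algebraic for every `p ∈ I` and EVERY `t ∈ S(ℂ)` (Ehresmann; the
transports of `(e⁻¹)^* κ_p` are the restrictions `W_p|_{𝒳_t}`; `hT` gives an open `W' ∋ s₀`; Bloch's countable-union step on the
irreducible base). Trust base: `hT`, `hCS`. [cite: BuchweitzFlenner2003, §5 Thm. 5.1 pp. 174–175; §6 Example 6.2; 7.18]
[cite: Bloch1972Semiregularity, proof of Thm. (7.4), last paragraph, p. 65] [cite: CharlesSchnell2014Notes, Prop. 11.3.11 (proof)] -/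
theorem deforms_model (hT : LocalVariationalHodgeFor 𝒪) (hCS : charlesSchnell_algebraicityLocus_iUnion_closed)
    {𝒳 S : SchemeOver ℂ} (f : 𝒳 ⟶ S) (hf : IsSmoothProjectiveFamily f n) (h𝒳 : IsQuasiProjectiveOver 𝒳)
    (hS : IsQuasiProjectiveOver S) (hSm : AlgebraicGeometry.Smooth S.hom) [IrreducibleSpace S.left]
    (s₀ : ComplexPoints S) (X₀ : SchemeOver ℂ) (e : X₀ ≅ fiberOver f s₀) (I : Finset ℕ)
    (κ : (p : ℕ) → complexBetti X₀ (2 * p)) (hκ : 𝒪 n X₀ I κ)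
    (W : (p : ℕ) → complexBetti 𝒳 (2 * p))
    (hW : ∀ p ∈ I, ∀ s : ComplexPoints S, IsOfHodgeType n (fiberOver f s) (2 * p) p p (Res[f, s, 2 * p, W p]))
    (hW₀ : ∀ p ∈ I, complexBetti.map e.hom (2 * p) (Res[f, s₀, 2 * p, W p]) = κ p)
    {p : ℕ} (hp : p ∈ I) (t : ComplexPoints S) :
    Res[f, t, 2 * p, W p] ∈ algebraicClasses (fiberOver f t) p := by
  classical
  haveI := hSm
  haveI : LocallyOfFiniteType S.hom := hS.locallyOfFiniteType
  haveI : ConnectedSpace (ComplexPoints S) := (ComplexPoints.connectedSpace_iff_holds S).2 inferInstance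
  -- `S(ℂ)` is a topological manifold of dimension `2d`, and `R^k f_* ℂ` is a local system on all of it
  obtain ⟨d, hd⟩ := exists_smoothOfRelativeDimension_of_connectedSpace_complexPoints S
  haveI := hd
  have hU : IsCohomologicallyLocallyTrivialOn f (Set.univ : Set (ComplexPoints S)) :=
    isCohomologicallyLocallyTrivialOn_univ_of_isSmoothProjectiveFamily f d hf hS
  letI := ComplexPoints.chartedSpace S d
  haveI : LocallyPathConnectedSpace (ComplexPoints S) :=
    ChartedSpace.locallyPathConnectedSpace (EuclideanSpace ℝ (Fin (2 * d))) (ComplexPoints S)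
  let s₀' : (Set.univ : Set (ComplexPoints S)) := ⟨s₀, Set.mem_univ s₀⟩
  -- `(e⁻¹)^* κ_p = W_p|_{𝒳_{s₀}}` for `p ∈ I`
  have hW₀' : ∀ p' ∈ I, complexBetti.map e.inv (2 * p') (κ p') = Res[f, s₀, 2 * p', W p'] := by
    intro p' hp'
    rw [← hW₀ p' hp', e.complexBetti_map_inv_map_hom]
  -- horizontality hypothesis: the transports of `(e⁻¹)^* κ_p` are the restrictions of `W_p`
  have hHodge : ∀ p' ∈ I, ∀ (t : (Set.univ : Set (ComplexPoints S)))
      (γ : Path.Homotopic.Quotient s₀' t),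
      IsOfHodgeType n (fiberOver f t.1) (2 * p') p' p'
        (transportFun f (2 * p') hU γ (complexBetti.map e.inv (2 * p') (κ p'))) := by
    intro p' hp' t γ
    rw [hW₀' p' hp', transportFun_map_fiberι f (2 * p') hU γ (W p')]
    exact hW p' hp' t.1
  obtain ⟨W', hWo, hW'₀, hWU, hW'⟩ := hT f n hf hSm hU s₀' X₀ e I κ hκ hHodge
  -- algebraic on the (open) path component of `s₀` in `W'`
  have hV : ∀ t ∈ pathComponentIn W' s₀,
      Res[f, t, 2 * p, W p] ∈ algebraicClasses (fiberOver f t) p := by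
    intro t ht
    have hj : JoinedIn W' s₀ t := ht
    let γ : Path (⟨s₀, hW'₀⟩ : W') ⟨t, pathComponentIn_subset ht⟩ :=
      { toFun := fun u ↦ ⟨hj.somePath u, hj.somePath_mem u⟩
        continuous_toFun := hj.somePath.continuous.subtype_mk _
        source' := Subtype.ext hj.somePath.source
        target' := Subtype.ext hj.somePath.target }
    have hmem : transportFun f (2 * p) (hU.mono hWU hWo) ⟦γ⟧ (complexBetti.map e.inv (2 * p) (κ p)) ∈
        algebraicClasses (fiberOver f t) p := hW' p hp ⟨t, pathComponentIn_subset ht⟩ ⟦γ⟧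
    have htr : transportFun f (2 * p) (hU.mono hWU hWo) ⟦γ⟧ (complexBetti.map e.inv (2 * p) (κ p)) =
        Res[f, t, 2 * p, W p] := by
      rw [hW₀' p hp]
      exact transportFun_map_fiberι f (2 * p) (hU.mono hWU hWo) ⟦γ⟧ (W p)
    rwa [htr] at hmem
  exact hCS.forall_mem_algebraicClasses_of_isOpen f n p h𝒳 hS hSm hf (W p)
    (hWo.pathComponentIn s₀) ⟨s₀, mem_pathComponentIn_self hW'₀⟩ hV t

end Global

/-! ## 2. The chart / component forms, one model -/

section ObjOn

variable {𝒴 M : SchemeOver ℂ} {g : 𝒴 ⟶ M} {𝒳 T : SchemeOver ℂ} {f : 𝒳 ⟶ T} {n p : ℕ}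

/-- **Transfer along a chart, `𝒪`-admissible representative ON A MODEL** (local statement for `𝒪`, global ∘ CDK chart): `κ` lives
on a model `e : X₀ ≅ 𝒳_{u₀}` of the chart fibre with `e^*(W_{p'}|_{𝒳_{u₀}}) = κ_{p'}` (`p' ∈ I`); if `(f, W_p)` sweeps a set `A` of fibre
classes of `g` (`p ∈ I`), every class in `A` is algebraic. [cite: BuchweitzFlenner2003, §5 Thm. 5.1, pp. 174–175; §6 Example 6.2]
[cite: Bloch1972Semiregularity, proof of Thm. (7.4), p. 65] [cite: CattaniDeligneKaplan1995JAMS, Thm. 1.1 and Cor. 1.2] -/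
theorem forall_mem_algebraicClasses_of_sweepsClasses (hT : LocalVariationalHodgeFor 𝒪)
    (hf : IsSmoothProjectiveFamily f n) (h𝒳 : IsQuasiProjectiveOver 𝒳) (hTq : IsQuasiProjectiveOver T)
    (hTs : _root_.AlgebraicGeometry.Smooth T.hom) [IrreducibleSpace T.left]
    (u₀ : ComplexPoints T) (X₀ : SchemeOver ℂ) (e : X₀ ≅ fiberOver f u₀) (I : Finset ℕ)
    (κ : (p' : ℕ) → complexBetti X₀ (2 * p')) (hκ : 𝒪 n X₀ I κ)
    (W : (p' : ℕ) → complexBetti 𝒳 (2 * p'))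
    (hW : ∀ p' ∈ I, ∀ u : ComplexPoints T,
      IsOfHodgeType n (fiberOver f u) (2 * p') p' p' (Res[f, u, 2 * p', W p']))
    (hW₀ : ∀ p' ∈ I, complexBetti.map e.hom (2 * p') (Res[f, u₀, 2 * p', W p']) = κ p')
    (hp : p ∈ I) {A : Set (FiberClass g (2 * p))} (hsweep : SweepsClasses g f (W p) A) :
    ∀ x ∈ A, x.cls ∈ algebraicClasses (fiberOver g x.pt) p :=
  fun _ hx => hsweep.mem_algebraicClasses
    (fun u => hT.deforms_model charlesSchnell_algebraicityLocus_iUnion_closed_holds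
      f hf h𝒳 hTq hTs u₀ X₀ e I κ hκ W hW hW₀ hp u) hx

/-- **Transfer along a chart, `𝒪`-admissible representative on a model, `q·hⁿ + w` shape**: the swept class is `V` with
`W_p = a • V + b • L`, `a, b ∈ ℚ`, `a ≠ 0`, `L` algebraic on every fibre (`V|_u = a⁻¹ • (W_p|_u - b • L|_u)`).
[cite: BuchweitzFlenner2003, §5 Thm. 5.1, pp. 174–175] [cite: Markman2025SecantWeil, §1.5] -/
theorem forall_mem_algebraicClasses_of_sweepsClasses_of_smul_add (hT : LocalVariationalHodgeFor 𝒪)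
    (hf : IsSmoothProjectiveFamily f n) (h𝒳 : IsQuasiProjectiveOver 𝒳) (hTq : IsQuasiProjectiveOver T)
    (hTs : _root_.AlgebraicGeometry.Smooth T.hom) [IrreducibleSpace T.left]
    (u₀ : ComplexPoints T) (X₀ : SchemeOver ℂ) (e : X₀ ≅ fiberOver f u₀) (I : Finset ℕ)
    (κ : (p' : ℕ) → complexBetti X₀ (2 * p')) (hκ : 𝒪 n X₀ I κ)
    (W : (p' : ℕ) → complexBetti 𝒳 (2 * p'))
    (hW : ∀ p' ∈ I, ∀ u : ComplexPoints T,
      IsOfHodgeType n (fiberOver f u) (2 * p') p' p' (Res[f, u, 2 * p', W p']))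
    (hW₀ : ∀ p' ∈ I, complexBetti.map e.hom (2 * p') (Res[f, u₀, 2 * p', W p']) = κ p')
    (hp : p ∈ I) (V L : complexBetti 𝒳 (2 * p)) (a b : ℚ) (ha : a ≠ 0)
    (hVL : W p = (a : ℂ) • V + (b : ℂ) • L)
    (hLalg : ∀ u : ComplexPoints T, Res[f, u, 2 * p, L] ∈ algebraicClasses (fiberOver f u) p)
    {A : Set (FiberClass g (2 * p))} (hsweep : SweepsClasses g f V A) :
    ∀ x ∈ A, x.cls ∈ algebraicClasses (fiberOver g x.pt) p := by
  have ha' : (a : ℂ) ≠ 0 := by exact_mod_cast ha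
  have hValg : ∀ u : ComplexPoints T, Res[f, u, 2 * p, V] ∈ algebraicClasses (fiberOver f u) p := by
    intro u
    have h1 : Res[f, u, 2 * p, W p] ∈ algebraicClasses (fiberOver f u) p :=
      hT.deforms_model charlesSchnell_algebraicityLocus_iUnion_closed_holds f hf h𝒳 hTq hTs u₀ X₀ e I κ hκ W hW hW₀ hp u
    rw [hVL, map_add, map_smul, map_smul] at h1
    have h2 : (a : ℂ) • Res[f, u, 2 * p, V] ∈ algebraicClasses (fiberOver f u) p := by
      have h3 := Submodule.sub_mem _ h1 (Submodule.smul_mem _ (b : ℂ) (hLalg u))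
      rwa [add_sub_cancel_right] at h3
    have h4 := Submodule.smul_mem _ (a : ℂ)⁻¹ h2
    rwa [smul_smul, inv_mul_cancel₀ ha', one_smul] at h4
  exact fun x hx => hsweep.mem_algebraicClasses hValg hx

/-- **The transfer chain with an `𝒪`-admissible representative on a model, component form**: `A = C.carrier`. Inputs BY NAME:
`hT` (the local statement for `𝒪`), `hsweep` (CDK chart). NOT inputs: CM-ness of the point, HC_CM, density, finiteness.
[cite: BuchweitzFlenner2003, §5 Thm. 5.1, pp. 174–175] [cite: CattaniDeligneKaplan1995JAMS, Thm. 1.1 and Cor. 1.2] -/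
theorem hc_on_component (hT : LocalVariationalHodgeFor 𝒪) (C : HodgeLocusComponent g n p)
    (hf : IsSmoothProjectiveFamily f n) (h𝒳 : IsQuasiProjectiveOver 𝒳) (hTq : IsQuasiProjectiveOver T)
    (hTs : _root_.AlgebraicGeometry.Smooth T.hom) [IrreducibleSpace T.left]
    (u₀ : ComplexPoints T) (X₀ : SchemeOver ℂ) (e : X₀ ≅ fiberOver f u₀) (I : Finset ℕ)
    (κ : (p' : ℕ) → complexBetti X₀ (2 * p')) (hκ : 𝒪 n X₀ I κ)
    (W : (p' : ℕ) → complexBetti 𝒳 (2 * p'))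
    (hW : ∀ p' ∈ I, ∀ u : ComplexPoints T,
      IsOfHodgeType n (fiberOver f u) (2 * p') p' p' (Res[f, u, 2 * p', W p']))
    (hW₀ : ∀ p' ∈ I, complexBetti.map e.hom (2 * p') (Res[f, u₀, 2 * p', W p']) = κ p')
    (hp : p ∈ I) (hsweep : SweepsClasses g f (W p) C.carrier) :
    ∀ x ∈ C.carrier, x.cls ∈ algebraicClasses (fiberOver g x.pt) p :=
  hT.forall_mem_algebraicClasses_of_sweepsClasses hf h𝒳 hTq hTs u₀ X₀ e I κ hκ W hW hW₀ hp hsweep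

/-- **Component form, `q·hⁿ + w` shape** (`W_p = a • V + b • L`, `a ≠ 0`, `L` fibrewise algebraic; the component is swept by `V`).
[cite: BuchweitzFlenner2003, §5 Thm. 5.1, pp. 174–175] [cite: Markman2025SecantWeil, §1.5] [cite: CattaniDeligneKaplan1995JAMS, Thm. 1.1] -/
theorem hc_on_component_of_smul_add (hT : LocalVariationalHodgeFor 𝒪) (C : HodgeLocusComponent g n p)
    (hf : IsSmoothProjectiveFamily f n) (h𝒳 : IsQuasiProjectiveOver 𝒳) (hTq : IsQuasiProjectiveOver T)
    (hTs : _root_.AlgebraicGeometry.Smooth T.hom) [IrreducibleSpace T.left]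
    (u₀ : ComplexPoints T) (X₀ : SchemeOver ℂ) (e : X₀ ≅ fiberOver f u₀) (I : Finset ℕ)
    (κ : (p' : ℕ) → complexBetti X₀ (2 * p')) (hκ : 𝒪 n X₀ I κ)
    (W : (p' : ℕ) → complexBetti 𝒳 (2 * p'))
    (hW : ∀ p' ∈ I, ∀ u : ComplexPoints T,
      IsOfHodgeType n (fiberOver f u) (2 * p') p' p' (Res[f, u, 2 * p', W p']))
    (hW₀ : ∀ p' ∈ I, complexBetti.map e.hom (2 * p') (Res[f, u₀, 2 * p', W p']) = κ p')
    (hp : p ∈ I) (V L : complexBetti 𝒳 (2 * p)) (a b : ℚ) (ha : a ≠ 0)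
    (hVL : W p = (a : ℂ) • V + (b : ℂ) • L)
    (hLalg : ∀ u : ComplexPoints T, Res[f, u, 2 * p, L] ∈ algebraicClasses (fiberOver f u) p)
    (hsweep : SweepsClasses g f V C.carrier) :
    ∀ x ∈ C.carrier, x.cls ∈ algebraicClasses (fiberOver g x.pt) p :=
  hT.forall_mem_algebraicClasses_of_sweepsClasses_of_smul_add hf h𝒳 hTq hTs u₀ X₀ e I κ hκ W hW hW₀ hp V L a b ha hVL
    hLalg hsweep

end ObjOn

/-! ## 3. On `𝒜_{g,δ,N}`: ONE `𝒪`-admissible family of classes on ONE model at ONE point of the component -/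

section Siegel

variable {g : ℕ} {δ : Fin g → ℕ} {N : ℕ}

/-- **The door-agnostic `𝒜_g` door at one component, ONE MODEL.** Granted the chart clause `SiegelHodgeLocusChartAt D p C` and the
local variational statement `LocalVariationalHodgeFor 𝒪`, a finite `I ∋ p`, global classes `Λ_{p'}` of the universal family
fibrewise `(p',p')` for `p' ∈ I` with `Λ_p` moreover fibrewise rational and algebraic (user: `θ^{p'}`), `(t₀, α₀) ∈ C`, rationals
`a ≠ 0`, `b`, `c_{p'}`, and — on ONE model `e : X₀ ≅ 𝒴_{t₀}` — ONE `𝒪`-admissible `κ` with `κ_p = e^*(a·α₀ + b·Λ_p|_{t₀})` and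
`κ_{p'} = e^*(c_{p'}·Λ_{p'}|_{t₀})` (`p' ∈ I ∖ {p}`): `α` is algebraic for EVERY `(t, α) ∈ C`. Proof: p3's
`hc_on_siegelComponent_of_sheafSeedOn_of_smul_add_at` verbatim with `ch(ℰ₀) ↦ κ` (chart fibre modelled by `e ≫ e₀⁻¹ : X₀ ≅ 𝒴_{t₀} ≅ 𝒳_{u₀}`).
Cell: `g = 2n`, `p = n`, `α₀ = w`, `Λ_{p'} = θ^{p'}`; route (C): `𝒪 = perfectObjClass C Adm` (seat p4). [cite: BuchweitzFlenner2003, §5 Thm. 5.1; §6 Example 6.2]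
[cite: CattaniDeligneKaplan1995JAMS, Thm. 1.1 and Cor. 1.2] [cite: Markman2025SecantWeil, §1.5]
[cite: FultonYoungTableaux1997, Appendix B §B.1 (1)] -/
theorem hc_on_siegelComponent_of_smul_add_at (hT : LocalVariationalHodgeFor 𝒪) {p : ℕ} {D : SiegelModuliDatum g δ N}
    {C : HodgeLocusComponent D.f g p} (hA : SiegelHodgeLocusChartAt D p C) (I : Finset ℕ) (hp : p ∈ I)
    (Λ : (p' : ℕ) → complexBetti D.𝒳 (2 * p'))
    (hΛ : ∀ p' ∈ I, ∀ s : ComplexPoints D.S, IsOfHodgeType g (fiberOver D.f s) (2 * p') p' p' (Res[D.f, s, 2 * p', Λ p']))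
    (hΛp : ∀ s : ComplexPoints D.S, IsRationalClass (Res[D.f, s, 2 * p, Λ p]) ∧
      Res[D.f, s, 2 * p, Λ p] ∈ algebraicClasses (fiberOver D.f s) p)
    {x₀ : FiberClass D.f (2 * p)} (hx₀ : x₀ ∈ C.carrier) (a b : ℚ) (ha : a ≠ 0) (c : ℕ → ℚ)
    (X₀ : SchemeOver ℂ) (e : X₀ ≅ fiberOver D.f x₀.pt)
    (κ : (p' : ℕ) → complexBetti X₀ (2 * p')) (hκ : 𝒪 g X₀ I κ)
    (hκp : κ p = complexBetti.map e.hom (2 * p) ((a : ℂ) • x₀.cls + (b : ℂ) • Res[D.f, x₀.pt, 2 * p, Λ p]))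
    (hκp' : ∀ p' ∈ I, p' ≠ p →
      κ p' = complexBetti.map e.hom (2 * p') (((c p' : ℚ) : ℂ) • Res[D.f, x₀.pt, 2 * p', Λ p'])) :
    ∀ x ∈ C.carrier, x.cls ∈ algebraicClasses (fiberOver D.f x.pt) p := by
  obtain ⟨𝒳, T, f, Φ, W, hf, h𝒳, hTq, hTs, hTi, hW, hΦ, hsw⟩ := hA
  haveI := hTi
  -- the pulled-back companion classes `L_{p'} = Φ^*Λ_{p'}`: fibrewise `(p',p')`, and `L_p` algebraic on every chart fibre
  have hLfib : ∀ p' ∈ I, ∀ u : ComplexPoints T,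
      IsOfHodgeType g (fiberOver f u) (2 * p') p' p' (Res[f, u, 2 * p', complexBetti.map Φ (2 * p') (Λ p')]) := by
    intro p' hp' u
    obtain ⟨s, e', he'⟩ := hΦ u
    rw [← map_res_eq_res_map_of_comm e' he']
    exact (isOfHodgeType_map_iff_of_iso e').2 (hΛ p' hp' s)
  have hLalg : ∀ u : ComplexPoints T,
      Res[f, u, 2 * p, complexBetti.map Φ (2 * p) (Λ p)] ∈ algebraicClasses (fiberOver f u) p := by
    intro u
    obtain ⟨s, e', he'⟩ := hΦ u
    rw [← map_res_eq_res_map_of_comm e' he']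
    exact (mem_algebraicClasses_map_iff_of_iso e').2 (hΛp s).2
  -- the special point on the chart; the model `X₀ ≅ 𝒴_{t₀} ≅ 𝒳_{u₀}` of the chart fibre
  obtain ⟨u₀, e₀, he₀Φ, he₀⟩ := hsw x₀ hx₀
  have hcomp : ∀ (k : ℕ) (y : complexBetti (fiberOver f u₀) k),
      complexBetti.map (e ≪≫ e₀.symm).hom k y = complexBetti.map e.hom k (complexBetti.map e₀.inv k y) := by
    intro k y
    rw [Iso.trans_hom, Iso.symm_hom, complexBetti.map_comp]
    rfl
  -- the global classes of the chart in the degrees `p' ∈ I`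
  let Wfam : (p' : ℕ) → complexBetti 𝒳 (2 * p') :=
    Function.update (fun p' => ((c p' : ℚ) : ℂ) • complexBetti.map Φ (2 * p') (Λ p')) p
      ((a : ℂ) • W + (b : ℂ) • complexBetti.map Φ (2 * p) (Λ p))
  have hWp : Wfam p = (a : ℂ) • W + (b : ℂ) • complexBetti.map Φ (2 * p) (Λ p) := Function.update_self _ _ _
  have hWne : ∀ p', p' ≠ p → Wfam p' = ((c p' : ℚ) : ℂ) • complexBetti.map Φ (2 * p') (Λ p') :=
    fun p' hne => Function.update_of_ne hne _ _
  have hWhodge : ∀ p' ∈ I, ∀ u : ComplexPoints T,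
      IsOfHodgeType g (fiberOver f u) (2 * p') p' p' (Res[f, u, 2 * p', Wfam p']) := by
    intro p' hp' u
    rcases eq_or_ne p' p with rfl | hne
    · rw [hWp, map_add, map_smul, map_smul]
      exact ((hW u).2.smul (a : ℂ)).add (hf.isSmoothProjective u) ((hLfib p' hp u).smul (b : ℂ))
    · rw [hWne p' hne, map_smul]
      exact (hLfib p' hp' u).smul _
  -- `(e ≫ e₀⁻¹)^*(W_{p'}|_{𝒳_{u₀}}) = κ_{p'}`
  have hW₀ : ∀ p' ∈ I, complexBetti.map (e ≪≫ e₀.symm).hom (2 * p') (Res[f, u₀, 2 * p', Wfam p']) = κ p' := by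
    intro p' hp'
    rw [hcomp]
    rcases eq_or_ne p' p with rfl | hne
    · have h1 : Res[f, u₀, 2 * p', Wfam p'] =
          complexBetti.map e₀.hom (2 * p') ((a : ℂ) • x₀.cls + (b : ℂ) • Res[D.f, x₀.pt, 2 * p', Λ p']) := by
        rw [hWp, map_add, map_smul, map_smul, map_add, map_smul, map_smul, he₀, map_res_eq_res_map_of_comm e₀ he₀Φ]
      rw [h1, e₀.complexBetti_map_inv_map_hom, hκp]
    · have h1 : Res[f, u₀, 2 * p', Wfam p'] =
          complexBetti.map e₀.hom (2 * p') (((c p' : ℚ) : ℂ) • Res[D.f, x₀.pt, 2 * p', Λ p']) := by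
        rw [hWne p' hne, map_smul, map_smul, map_res_eq_res_map_of_comm e₀ he₀Φ]
      rw [h1, e₀.complexBetti_map_inv_map_hom, hκp' p' hp' hne]
  have hsweep : SweepsClasses D.f f W C.carrier := fun x hx => by
    obtain ⟨u, e', -, he'⟩ := hsw x hx
    exact ⟨u, e', he'⟩
  exact hT.forall_mem_algebraicClasses_of_sweepsClasses_of_smul_add hf h𝒳 hTq hTs u₀ X₀ (e ≪≫ e₀.symm) I κ hκ Wfam hWhodge
    hW₀ hp W (complexBetti.map Φ (2 * p) (Λ p)) a b ha hWp hLalg hsweep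

/-- **The door-agnostic `𝒜_g` door, one model, on base-chart data at the component** (`SiegelHodgeLocusBaseChartAt D p C`) **and
Deligne's théorème de la partie fixe**, through theory seat 3's `siegelHodgeLocusChartAt_of_baseChartAt`. [cite: BuchweitzFlenner2003, §5 Thm. 5.1]
[cite: DeligneHodgeII1971, Théorème 4.1.1] [cite: MoonenOort2013Torelli, §3 Def. (Version 2) and (d)] -/
theorem hc_on_siegelComponent_of_smul_add_of_baseChartAt (hT : LocalVariationalHodgeFor 𝒪) {p : ℕ}
    {D : SiegelModuliDatum g δ N} {C : HodgeLocusComponent D.f g p} (hS : SiegelHodgeLocusBaseChartAt D p C)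
    (hGIC : deligne_globalInvariantCycles) (I : Finset ℕ) (hp : p ∈ I)
    (Λ : (p' : ℕ) → complexBetti D.𝒳 (2 * p'))
    (hΛ : ∀ p' ∈ I, ∀ s : ComplexPoints D.S, IsOfHodgeType g (fiberOver D.f s) (2 * p') p' p' (Res[D.f, s, 2 * p', Λ p']))
    (hΛp : ∀ s : ComplexPoints D.S, IsRationalClass (Res[D.f, s, 2 * p, Λ p]) ∧
      Res[D.f, s, 2 * p, Λ p] ∈ algebraicClasses (fiberOver D.f s) p)
    {x₀ : FiberClass D.f (2 * p)} (hx₀ : x₀ ∈ C.carrier) (a b : ℚ) (ha : a ≠ 0) (c : ℕ → ℚ)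
    (X₀ : SchemeOver ℂ) (e : X₀ ≅ fiberOver D.f x₀.pt)
    (κ : (p' : ℕ) → complexBetti X₀ (2 * p')) (hκ : 𝒪 g X₀ I κ)
    (hκp : κ p = complexBetti.map e.hom (2 * p) ((a : ℂ) • x₀.cls + (b : ℂ) • Res[D.f, x₀.pt, 2 * p, Λ p]))
    (hκp' : ∀ p' ∈ I, p' ≠ p →
      κ p' = complexBetti.map e.hom (2 * p') (((c p' : ℚ) : ℂ) • Res[D.f, x₀.pt, 2 * p', Λ p'])) :
    ∀ x ∈ C.carrier, x.cls ∈ algebraicClasses (fiberOver D.f x.pt) p :=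
  hT.hc_on_siegelComponent_of_smul_add_at (siegelHodgeLocusChartAt_of_baseChartAt hS hGIC) I hp Λ hΛ hΛp hx₀ a b ha c X₀ e
    κ hκ hκp hκp'

/-- **The door-agnostic `𝒜_g` door, one model, universal chart form**: the chart assumption `SiegelHodgeLocusChart g δ N` for every
datum, degree and component, used at `(D, p, C)` (`hA.chartAt D p C`). [cite: BuchweitzFlenner2003, §5 Thm. 5.1; §6 Example 6.2]
[cite: CattaniDeligneKaplan1995JAMS, Thm. 1.1 and Cor. 1.2] [cite: Markman2025SecantWeil, §1.5] -/
theorem hc_on_siegelComponent_of_smul_add (hT : LocalVariationalHodgeFor 𝒪) (hA : SiegelHodgeLocusChart g δ N) {p : ℕ}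
    (D : SiegelModuliDatum g δ N) (C : HodgeLocusComponent D.f g p) (I : Finset ℕ) (hp : p ∈ I)
    (Λ : (p' : ℕ) → complexBetti D.𝒳 (2 * p'))
    (hΛ : ∀ p' ∈ I, ∀ s : ComplexPoints D.S, IsOfHodgeType g (fiberOver D.f s) (2 * p') p' p' (Res[D.f, s, 2 * p', Λ p']))
    (hΛp : ∀ s : ComplexPoints D.S, IsRationalClass (Res[D.f, s, 2 * p, Λ p]) ∧
      Res[D.f, s, 2 * p, Λ p] ∈ algebraicClasses (fiberOver D.f s) p)
    {x₀ : FiberClass D.f (2 * p)} (hx₀ : x₀ ∈ C.carrier) (a b : ℚ) (ha : a ≠ 0) (c : ℕ → ℚ)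
    (X₀ : SchemeOver ℂ) (e : X₀ ≅ fiberOver D.f x₀.pt)
    (κ : (p' : ℕ) → complexBetti X₀ (2 * p')) (hκ : 𝒪 g X₀ I κ)
    (hκp : κ p = complexBetti.map e.hom (2 * p) ((a : ℂ) • x₀.cls + (b : ℂ) • Res[D.f, x₀.pt, 2 * p, Λ p]))
    (hκp' : ∀ p' ∈ I, p' ≠ p →
      κ p' = complexBetti.map e.hom (2 * p') (((c p' : ℚ) : ℂ) • Res[D.f, x₀.pt, 2 * p', Λ p'])) :
    ∀ x ∈ C.carrier, x.cls ∈ algebraicClasses (fiberOver D.f x.pt) p :=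
  hT.hc_on_siegelComponent_of_smul_add_at (hA.chartAt D p C) I hp Λ hΛ hΛp hx₀ a b ha c X₀ e κ hκ hκp hκp'

end Siegel

end LocalVariationalHodgeFor

/-! ### The g = 4 reading and the sanity instance -/

section FourfoldsAndSanity

variable {δ : Fin 4 → ℕ} {N : ℕ}

/-- **g = 4, per-component form of the amplification chain** (the coordinator's sentence «a semiregular representative at ONE point
of a Hodge-locus component ⟹ HC on THAT component», door-agnostic): on the universal family of `𝒜_{4,δ,N}` (`D : SiegelModuliDatum 4 δ N`),
a connected component `C` of the locus of rational `(2,2)`-classes, granted the base chart at `C` (cell assumption, theory seats 2/3)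
and `deligne_globalInvariantCycles` (cited), the local variational statement for `𝒪`, a fibrewise rational-algebraic `(2,2)` global
class `Λ_2` and fibrewise `(p',p')` companions `Λ_{p'}` (`p' ∈ I`; user: powers of the relative polarisation), a point `(t₀, α₀) ∈ C`
and ONE `𝒪`-admissible `κ` on ONE model `X₀ ≅ 𝒴_{t₀}` with `κ_2 = e^*(a·α₀ + b·Λ_2|_{t₀})`, `a ≠ 0`, `κ_{p'} = e^*(c_{p'}·Λ_{p'}|_{t₀})`:
`α` is algebraic on `𝒴_t` for EVERY `(t, α) ∈ C`. [cite: BuchweitzFlenner2003, §5 Thm. 5.1 (binder shape)]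
[cite: DeligneHodgeII1971, Théorème 4.1.1] [cite: CattaniDeligneKaplan1995JAMS, Thm. 1.1 and Cor. 1.2] -/
theorem hc_on_siegelFourfoldComponent_of_localVariationalHodgeFor_of_baseChartAt {𝒪 : ObjClass}
    (hT : LocalVariationalHodgeFor 𝒪) {D : SiegelModuliDatum 4 δ N} {C : HodgeLocusComponent D.f 4 2}
    (hS : SiegelHodgeLocusBaseChartAt D 2 C) (hGIC : deligne_globalInvariantCycles) (I : Finset ℕ) (h2 : 2 ∈ I)
    (Λ : (p' : ℕ) → complexBetti D.𝒳 (2 * p'))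
    (hΛ : ∀ p' ∈ I, ∀ s : ComplexPoints D.S, IsOfHodgeType 4 (fiberOver D.f s) (2 * p') p' p' (Res[D.f, s, 2 * p', Λ p']))
    (hΛ2 : ∀ s : ComplexPoints D.S, IsRationalClass (Res[D.f, s, 2 * 2, Λ 2]) ∧
      Res[D.f, s, 2 * 2, Λ 2] ∈ algebraicClasses (fiberOver D.f s) 2)
    {x₀ : FiberClass D.f (2 * 2)} (hx₀ : x₀ ∈ C.carrier) (a b : ℚ) (ha : a ≠ 0) (c : ℕ → ℚ)
    (X₀ : SchemeOver ℂ) (e : X₀ ≅ fiberOver D.f x₀.pt)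
    (κ : (p' : ℕ) → complexBetti X₀ (2 * p')) (hκ : 𝒪 4 X₀ I κ)
    (hκ2 : κ 2 = complexBetti.map e.hom (2 * 2) ((a : ℂ) • x₀.cls + (b : ℂ) • Res[D.f, x₀.pt, 2 * 2, Λ 2]))
    (hκp' : ∀ p' ∈ I, p' ≠ 2 →
      κ p' = complexBetti.map e.hom (2 * p') (((c p' : ℚ) : ℂ) • Res[D.f, x₀.pt, 2 * p', Λ p'])) :
    ∀ x ∈ C.carrier, x.cls ∈ algebraicClasses (fiberOver D.f x.pt) 2 :=
  hT.hc_on_siegelComponent_of_smul_add_of_baseChartAt hS hGIC I h2 Λ hΛ hΛ2 hx₀ a b ha c X₀ e κ hκ hκ2 hκp'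

variable {g : ℕ} {δ' : Fin g → ℕ}

/-- **SANITY INSTANCE — p3's one-model vector-bundle door D2 recovered through the abstraction** (same statement as
`hc_on_siegelComponent_of_sheafSeedOn_of_smul_add_at`, in three lines: `𝒪 := bfSheafClass Cc`, `κ := ch(ℰ₀)`).
[cite: BuchweitzFlenner2003, §5 Thm. 5.1; §6 Example 6.2] [cite: CattaniDeligneKaplan1995JAMS, Thm. 1.1 and Cor. 1.2] -/
theorem hc_on_siegelComponent_of_sheafSeedOn_of_smul_add_at' {p : ℕ} {D : SiegelModuliDatum g δ' N}
    {C : HodgeLocusComponent D.f g p} (hA : SiegelHodgeLocusChartAt D p C)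
    (hBF : BuchweitzFlenner2003_variationalHodge_ISemiregular_model) (Cc : ChernCharacterBetti)
    (I : Finset ℕ) (hp : p ∈ I)
    (Λ : (p' : ℕ) → complexBetti D.𝒳 (2 * p'))
    (hΛ : ∀ p' ∈ I, ∀ s : ComplexPoints D.S, IsOfHodgeType g (fiberOver D.f s) (2 * p') p' p' (Res[D.f, s, 2 * p', Λ p']))
    (hΛp : ∀ s : ComplexPoints D.S, IsRationalClass (Res[D.f, s, 2 * p, Λ p]) ∧
      Res[D.f, s, 2 * p, Λ p] ∈ algebraicClasses (fiberOver D.f s) p)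
    {x₀ : FiberClass D.f (2 * p)} (hx₀ : x₀ ∈ C.carrier) (a b : ℚ) (ha : a ≠ 0) (c : ℕ → ℚ)
    (X₀ : SchemeOver ℂ) (e : X₀ ≅ fiberOver D.f x₀.pt)
    (E₀ : X₀.left.Modules) (hE₀ : IsFiniteLocallyFree E₀) (hsr : IsISemiregular hE₀ {q | q + 1 ∈ I})
    (hchp : Cc.ch X₀ E₀ p =
      complexBetti.map e.hom (2 * p) ((a : ℂ) • x₀.cls + (b : ℂ) • Res[D.f, x₀.pt, 2 * p, Λ p]))
    (hchp' : ∀ p' ∈ I, p' ≠ p →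
      Cc.ch X₀ E₀ p' = complexBetti.map e.hom (2 * p') (((c p' : ℚ) : ℂ) • Res[D.f, x₀.pt, 2 * p', Λ p'])) :
    ∀ x ∈ C.carrier, x.cls ∈ algebraicClasses (fiberOver D.f x.pt) p :=
  (localVariationalHodgeFor_bfSheafClass hBF Cc).hc_on_siegelComponent_of_smul_add_at hA I hp Λ hΛ hΛp hx₀ a b ha c X₀ e
    (fun p' ↦ Cc.ch X₀ E₀ p') ⟨E₀, hE₀, hsr, fun _ _ ↦ rfl⟩ hchp hchp'

end FourfoldsAndSanity

end Summit.Ventures.HSemireg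

end
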